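import Literature.NumberTheory.Automorphic.ReciprocityGLn
import HarnessLib

/-!
# Weight shifting modulo `p` for Hilbert modular eigenforms by partial Hasse invariants

Topic `Literature/NumberTheory/Automorphic` (vocabulary of `AutomorphicRepsGL`, `InfinityType`,
`ReciprocityGLn`: `CuspidalAutomorphicRepData`, `AutomorphicRepData.HasInfinityType`,
`HasSatakeParamAt`, `IsUnramifiedAt`, `arithFrobPolyOfSatake`).  Requested by route
`EvenArtinGL4Door` of summit `Langlands` (support item `ResidualDoorMod2`, used with `p = 2` over a
real quadratic field): the existence of characteristic-zero Hilbert cuspidal eigenforms of shifted,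
non-parallel paritious weight congruent modulo `p` to a given one.

## The printed results and how they are combined

Let `L` be a totally real field of degree `g > 1`, `p` a prime **unramified** in `L`, `𝔽 ⊇ 𝔽_p`
large enough, `Σ` the set of embeddings `τ` of `𝓞 L / p` into `𝔽` (identified, `p` being
unramified, with the real embeddings of `L` once `ι : ℚ̄_p ≃ ℂ` is fixed), `Fr` the arithmetic
Frobenius acting on `Σ` by `τ ↦ (x ↦ τ(x)^p)`, and `Sh^tor` a toroidal compactification of the
Hilbert modular variety of level `Γ₀₀(N)`, `N ≥ 4` prime to `p`, with boundary `D` and automorphic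
line bundles `ω^{(k,w)}` for paritious weights `(k, w) ∈ ℤ^Σ × ℤ` (`k_τ ≡ w mod 2`).

* (Partial Hasse invariants; Goren 2001 and Andreatta–Goren 2005 §7–8, in the form of
  Emerton–Reduzzi–Xiao, §3.1, where `p` is only assumed unramified.)  For every `τ ∈ Σ` there is
  a mod `p` Hilbert modular form `h_τ ∈ H⁰(Sh^tor_𝔽, ω_{Fr⁻¹∘τ}^{⊗ p} ⊗ ω_τ^{⊗ -1})`, of weight
  `p·e_{Fr⁻¹∘τ} - e_τ`, invariant under prime-to-`p` `𝓞_L`-isogenies of the test object, and for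
  every paritious `(k, w)` multiplication by `h_τ²` is a **Hecke-equivariant** embedding
  `ω^{(k,w)}(-D) ↪ ω^{(k + 2p e_{Fr⁻¹∘τ} - 2e_τ, w)}(-D)` (ERX §3.1: Remark 3.1.1, Lemma 3.1.2,
  Cor. 3.1.3 in the numbering of arXiv:1307.8003, counted per subsection; Reduzzi–Xiao 2017 §3
  for every `p`).  Hence a mod `p` cuspidal Hecke eigenform of weight `(k, w)` times `∏_τ h_τ^{M_τ}`
  (`M_τ` EVEN — odd powers are not Hecke-equivariant for the normalised operators, already for
  `L = ℚ`) is a mod `p` cuspidal Hecke eigenform of weight `(k + Σ_τ M_τ (p e_{Fr⁻¹∘τ} - e_τ), w)`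
  with the SAME eigenvalues of the `T_𝔞`, `𝔞` prime to `pN` (and of the prime-to-`pN` central
  operators); note `Σ_τ (p e_{Fr⁻¹∘τ} - e_τ) = (p-1)·1`, realised by the total Hasse invariant.
* (The cone lemma; ERX §4.2, Lemma 4.2.2 = the Lemma following Definition 4.2.1 of a favorable
  weight; Reduzzi–Xiao 2017 §4.2, the first Proposition there, for every `p`.)  For every
  paritious `(k, w)` there is `n₀ = n₀(k, w)` such that for all `n ≥ n₀` and all `i > 0`,
  `H^i(Sh^tor_𝔽, ω^{(k + n·2, w)}(-D)) = 0` and `H^i(Sh^tor_{𝒪_E}, ω^{(k + n·2, w)}(-D)) = 0`.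
  Consequently (ERX §4.3, proof of Lemma 4.3.2: "since `k` belongs to `Δ_w` and it is regular,
  `H⁰(Sh^tor, ω^{(k,w)}(-D))` is of Galois type") the reduction map
  `H⁰(Sh^tor_{𝒪_E}, ω^{(k',w)}(-D)) ⊗ 𝔽 → H⁰(Sh^tor_𝔽, ω^{(k',w)}(-D))` is an isomorphism for
  `k' = k + n·2`, `n ≥ n₀`, its source being a finite free `𝒪_E`-module with commuting Hecke
  (and central) operators.
* (Deligne–Serre lifting lemma, Lemme 6.11 — PROVED in the tree,
  `Literature.RingTheory.DiscreteValuationRing.DeligneSerre1974.lemma611_holds`.)  A system of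
  eigenvalues of a commuting family occurring on `M ⊗ 𝔽`, `M` finite free over `𝒪_E`, lifts to
  an `𝒪_{E'}`-valued system occurring on `M ⊗ E'` for a finite extension `E'/E`.

Chaining the three (the parallel part of the shift being realised by even powers of the total
Hasse invariant `∏_τ h_τ`, of weight `(p-1)·1`): if a system of eigenvalues of the `T_𝔞` and of
the central operators (`𝔞` prime to `pN`) occurs on characteristic-zero cusp forms of paritious
weight `(k, w)` and level `Γ₀₀(N)`, then for every `M ∈ (2ℤ_{≥0})^Σ` there is `n₀` such that for
every `n ≥ n₀` a system congruent to it modulo the maximal ideal of `ℤ̄_p` occurs on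
characteristic-zero cusp forms of weight
`(k + Σ_τ (M_τ + 2n)(p e_{Fr⁻¹∘τ} - e_τ), w) = (k + Σ_τ M_τ (p e_{Fr⁻¹∘τ} - e_τ) + 2n(p-1)·1, w)` and
the same level; the Galois representations of the two eigenforms (Carayol, Taylor,
Blasius–Rogawski; tree: `exists_galoisRep_of_regularAlgebraic`), whose Frobenius traces are the
`T_v`-eigenvalues in this `(k, w)`-normalisation and whose determinants are read off `w` and the
central characters, then have congruent Frobenius characteristic polynomials at every `v ∤ pN`
(equivalently, by Chebotarev and Brauer–Nesbitt, isomorphic semisimplified reductions).  This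
is the named fact
`HilbertPartialHasseWeightShifting` below, written for the cuspidal automorphic representations
of `GL₂(𝔸_L)` generated by the eigenforms, since the tree has no Hilbert modular varieties:
"holomorphic of weight `(k, w)`" is recorded through the infinity type (`hilbertInfinityType`,
`AutomorphicRepData.IsHolomorphicHilbert`), "level prime to `p`" as "unramified at every
`v ∣ p`", the embeddings are indexed by `β : L →+* ℂ` and the Frobenius permutation of `Σ` is
transported along `ι : ℚ̄_p ≃+* ℂ` (`IsFrobeniusTwist`), and the congruence of Hecke eigenvalues
at almost all places is written, as in the route, as the coefficientwise congruence of the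
Frobenius polynomials `arithFrobPolyOfSatake ι q_v 2 α` of `ReciprocityGLn` (for `π, π'` of the
same `w` these differ from the polynomials `X² - t_v X + q_v s_v` of `T_v, S_v`-eigenvalues by
the same unit renormalisation at `v ∤ p`, so the two congruences are equivalent).

Remarks on scope (recorded, not vendored).  (1) ERX assume `p` inert from their §3.3 on and state
(Introduction) that the proofs "extend immediately to the unramified case"; Reduzzi–Xiao 2017
treat every `p` on the Pappas–Rapoport splitting model — for ramified `p` the weights of the
generalized partial Hasse invariants are different and are NOT covered by the statement below,
which assumes `p ∤ disc L`.  (2) Lifting a mod `p` eigenform to characteristic zero *in the same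
weight* is not known in general (it fails in parallel weight one, and for regular weights it is
known only in a cone; cf. Diamond–Sasaki, JEMS (2023), Conj. 7.5.2 and Prop. 7.5.4); this is why
the statement carries the parallel shift `2n(p-1)·1` with `n ≥ n₀`.  (3) The algebraic
counterpart (Buzzard–Diamond–Jarvis 2010, Prop. 2.5: for `ρ̄` irreducible and totally odd,
`ρ̄ ≅ ρ̄_π` for some `π` of weight `(k, w)` and level prime to `ℓ` iff `ρ̄` is modular of some
Jordan–Hölder constituent of `V_{k,w}`) needs quaternionic Shimura curves and is not vendored.

## Contents

* `hilbertArchWeight k w`, `hilbertArchWeights k w`, `hilbertInfinityType k w` — the infinity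
  type of a holomorphic Hilbert modular form of weight `(k, w)`: at `β` the `z`-exponents
  `((k_β-1-w)/2, (1-k_β-w)/2)` of the discrete series `D_{k_β,w}` and their swap; API (proved)
  `card_hilbertArchWeights`, `hilbertArchWeights_map_swap`, `hilbertInfinityType_isWellFormed`,
  `hilbertInfinityType_isCAlgebraic`, `hilbertInfinityType_isRegular`,
  `hilbertInfinityType_isRegularAlgebraic`.
* `AutomorphicRepData.IsHolomorphicHilbert π k w` and `IsHolomorphicHilbert.isRegularAlgebraic`
  (so that `exists_galoisRep_of_regularAlgebraic` applies to both representations of the fact).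
* `IsFrobeniusTwist p ι β γ` — "`γ̄ = Frob ∘ β̄` on the integers of `L`", read through `ι`.
* `HilbertPartialHasseWeightShifting` — the named fact (D-0014).

Mathlib has no automorphic representations, Hilbert modular forms or Hasse invariants; the
automorphic vocabulary is the tree's (`AutomorphicRepsGL`, `InfinityType`, `ReciprocityGLn`).

## References

* M. Emerton, D. Reduzzi, L. Xiao, *Galois representations and torsion in the coherent cohomology
  of Hilbert modular varieties*, J. reine angew. Math. 726 (2017), 93–127 (arXiv:1307.8003):
  Introduction; §2.2 (paritious weights, Hecke operators); §3.1 (partial Hasse invariants, Hecke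
  equivariance); §4.2 (favorable weights, the cone lemma); §4.3 (weight shifting tricks).
  [EmertonReduzziXiao2017]
* D. Reduzzi, L. Xiao, *Partial Hasse invariants on splitting models of Hilbert modular
  varieties*, Ann. Sci. ÉNS 50 (2017), 579–607 (arXiv:1405.6349): Thm. 1.1, §2.5–2.6, §3, §4.2.
  [ReduzziXiao2017]
* F. Andreatta, E. Goren, *Hilbert modular forms: mod p and p-adic aspects*, Mem. AMS 173
  no. 819 (2005), §7–8. [AndreattaGoren2005]
* E. Goren, *Hasse invariants for Hilbert modular varieties*, Israel J. Math. 122 (2001),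
  157–174. [Goren2001]
* P. Deligne, J.-P. Serre, *Formes modulaires de poids 1*, Ann. Sci. ÉNS 7 (1974), Lemme 6.11.
  [DeligneSerreASENS1974]
* K. Buzzard, F. Diamond, F. Jarvis, *On Serre's conjecture for mod `ℓ` Galois representations
  over totally real fields*, Duke Math. J. 155 (2010), §2 ("holomorphic of weight `(k, w)`",
  Prop. 2.5, Cor. 2.6). [BuzzardDiamondJarvis2010]
-/

noncomputable section

open scoped MatrixGroups Matrix Classical Polynomial NumberField
open NumberField IsDedekindDomain

namespace Literature.NumberTheory.Automorphic

/-! ### The infinity type of a holomorphic Hilbert modular form of weight `(k, w)` -/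

section InfinityTypes

variable {L : Type*} [Field L]

/-- The archimedean weight `(a, b) = ((k-1-w)/2, (1-k-w)/2)` (`a - b = k - 1 ∈ ℤ`): together
with its swap, the restriction to `ℂˣ` of the Langlands parameter of the discrete series
`D_{k,w}` of `GL₂(ℝ)` of lowest weight `k ≥ 2` and central character `t ↦ t^{-w}`
(Carayol's `D_{k,w}`; Buzzard–Diamond–Jarvis 2010, §2, before Prop. 2.5).  For `k = 2, w = 0`
the pair is the weight-zero (cohomological) pair `{(1/2,-1/2), (-1/2,1/2)}` of
`weightZeroInfinityType`. [cite: BuzzardDiamondJarvis2010, §2 (before Prop. 2.5)] -/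
def hilbertArchWeight (k : ℕ) (w : ℤ) : ArchWeight :=
  ⟨((k : ℂ) - 1 - w) / 2, (1 - (k : ℂ) - w) / 2, ⟨(k : ℤ) - 1, by push_cast; ring⟩⟩

/-- The `a`-exponent of `hilbertArchWeight k w`. [folklore] -/
@[simp] theorem hilbertArchWeight_a (k : ℕ) (w : ℤ) :
    (hilbertArchWeight k w).a = ((k : ℂ) - 1 - w) / 2 := rfl

/-- The `b`-exponent of `hilbertArchWeight k w`. [folklore] -/
@[simp] theorem hilbertArchWeight_b (k : ℕ) (w : ℤ) :
    (hilbertArchWeight k w).b = (1 - (k : ℂ) - w) / 2 := rfl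

/-- The two archimedean weights `{(a, b), (b, a)}` of `D_{k,w}` (see `hilbertArchWeight`).
[cite: BuzzardDiamondJarvis2010, §2 (before Prop. 2.5)] -/
def hilbertArchWeights (k : ℕ) (w : ℤ) : Multiset ArchWeight :=
  {hilbertArchWeight k w, (hilbertArchWeight k w).swap}

/-- There are two archimedean weights at each real place. [folklore] -/
@[simp] theorem card_hilbertArchWeights (k : ℕ) (w : ℤ) :
    Multiset.card (hilbertArchWeights k w) = 2 := rfl

/-- The pair of weights of `D_{k,w}` is stable under swapping the exponents (the parameter comes
from a representation of `GL₂(ℝ)`). [folklore] -/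
theorem hilbertArchWeights_map_swap (k : ℕ) (w : ℤ) :
    (hilbertArchWeights k w).map ArchWeight.swap = hilbertArchWeights k w := by
  simp only [hilbertArchWeights, Multiset.insert_eq_cons, Multiset.map_cons,
    Multiset.map_singleton, ArchWeight.swap_swap]
  exact Multiset.cons_swap _ _ 0

/-- **The infinity type of a holomorphic Hilbert modular form of weight `(k, w)`** over the
(totally real) field `L`, `k = (k_β)_β` indexed by the embeddings `β : L →+* ℂ`: at `β` the two
weights of `D_{k_β, w}` (`hilbertArchWeights`).  A cuspidal automorphic representation `π` of
`GL₂(𝔸_L)` is "holomorphic of weight `(k, w)`" (Buzzard–Diamond–Jarvis 2010, §2: `π_β ≅ D_{k_β,w}`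
at every real place) iff — `π_β` being irreducible, unitary up to twist and infinite-dimensional —
it has this infinity type, for `k_β ≥ 2`; the tree records archimedean components only through
their infinity types (`AutomorphicRepData.HasInfinityType`, cf. `HasWeightZero`).
[cite: BuzzardDiamondJarvis2010, §2 (before Prop. 2.5)] -/
def hilbertInfinityType (k : (L →+* ℂ) → ℕ) (w : ℤ) : InfinityType L 2 :=
  fun β ↦ hilbertArchWeights (k β) w

/-- Unfolding `hilbertInfinityType` at an embedding. [folklore] -/
@[simp] theorem hilbertInfinityType_apply (k : (L →+* ℂ) → ℕ) (w : ℤ) (β : L →+* ℂ) :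
    hilbertInfinityType k w β = hilbertArchWeights (k β) w := rfl

/-- The infinity type of weight `(k, w)` is well formed as soon as `k` is constant on
complex-conjugate pairs of embeddings (automatic over a totally real field,
`hilbertInfinityType_isWellFormed`). [folklore] -/
theorem hilbertInfinityType_isWellFormed_of_conjugate {k : (L →+* ℂ) → ℕ} (w : ℤ)
    (hk : ∀ β : L →+* ℂ, k (ComplexEmbedding.conjugate β) = k β) :
    (hilbertInfinityType k w).IsWellFormed :=
  ⟨fun _ ↦ rfl, fun β ↦ by rw [hilbertInfinityType_apply, hilbertInfinityType_apply, hk β,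
    hilbertArchWeights_map_swap]⟩

/-- Over a totally real field every infinity type of weight `(k, w)` is well formed (all
embeddings are real, Mathlib `IsTotallyReal.complexEmbedding_isReal`). [folklore] -/
theorem hilbertInfinityType_isWellFormed [IsTotallyReal L] (k : (L →+* ℂ) → ℕ) (w : ℤ) :
    (hilbertInfinityType k w).IsWellFormed :=
  hilbertInfinityType_isWellFormed_of_conjugate w fun β ↦ by
    rw [ComplexEmbedding.isReal_iff.mp (IsTotallyReal.complexEmbedding_isReal β)]

/-- A paritious weight (`k_β ≡ w mod 2` for all `β`) has a C-algebraic infinity type: the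
exponents lie in `1/2 + ℤ` (Clozel; Buzzard–Gee 2014, Def. 3.1.1). [folklore] -/
theorem hilbertInfinityType_isCAlgebraic {k : (L →+* ℂ) → ℕ} {w : ℤ}
    (hpar : ∀ β : L →+* ℂ, (2 : ℤ) ∣ (k β : ℤ) - w) : (hilbertInfinityType k w).IsCAlgebraic := by
  intro β q hq
  obtain ⟨c, hc⟩ := hpar β
  have hc' : ((k β : ℕ) : ℂ) = (w : ℂ) + 2 * (c : ℂ) := by
    have h := congrArg (fun z : ℤ ↦ (z : ℂ)) hc
    push_cast at h
    linear_combination h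
  simp only [hilbertInfinityType_apply, hilbertArchWeights, Multiset.insert_eq_cons,
    Multiset.mem_cons, Multiset.mem_singleton] at hq
  rcases hq with rfl | rfl
  · refine ⟨c - 1, -c - w, ?_, ?_⟩
    · simp only [hilbertArchWeight_a, hc']
      push_cast
      ring
    · simp only [hilbertArchWeight_b, hc']
      push_cast
      ring
  · refine ⟨-c - w, c - 1, ?_, ?_⟩
    · simp only [ArchWeight.swap_a, hilbertArchWeight_b, hc']
      push_cast
      ring
    · simp only [ArchWeight.swap_b, hilbertArchWeight_a, hc']
      push_cast
      ring

/-- If no `k_β` equals `1`, the infinity type of weight `(k, w)` is regular: the two exponents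
`(k_β-1-w)/2 ≠ (1-k_β-w)/2` at every `β` (Clozel 1990, Déf. 3.12). [folklore] -/
theorem hilbertInfinityType_isRegular {k : (L →+* ℂ) → ℕ} (w : ℤ)
    (hk : ∀ β : L →+* ℂ, k β ≠ 1) : (hilbertInfinityType k w).IsRegular := by
  intro β
  simp only [hilbertInfinityType_apply, hilbertArchWeights, Multiset.insert_eq_cons,
    Multiset.map_cons, Multiset.map_singleton, ArchWeight.swap_a, hilbertArchWeight_a,
    hilbertArchWeight_b, Multiset.nodup_cons, Multiset.mem_singleton, Multiset.nodup_singleton,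
    and_true]
  intro h
  have h1 : ((k β : ℕ) : ℂ) = 1 := by linear_combination h
  exact hk β (by exact_mod_cast h1)

/-- **A regular paritious weight has a regular algebraic infinity type** (Clozel): `k_β ≥ 2` and
`k_β ≡ w mod 2` for all `β`. [folklore] -/
theorem hilbertInfinityType_isRegularAlgebraic {k : (L →+* ℂ) → ℕ} {w : ℤ}
    (hpar : ∀ β : L →+* ℂ, (2 : ℤ) ∣ (k β : ℤ) - w) (hk : ∀ β : L →+* ℂ, 2 ≤ k β) :
    (hilbertInfinityType k w).IsRegularAlgebraic :=
  ⟨hilbertInfinityType_isCAlgebraic hpar,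
    hilbertInfinityType_isRegular w fun β h ↦ by have := hk β; omega⟩

end InfinityTypes

/-! ### Holomorphic Hilbert cuspidal automorphic representations of weight `(k, w)` -/

namespace AutomorphicRepData

variable {L : Type} [Field L] [NumberField L] {hcpt : isCompact_glFiniteIntegralLevel 2 L}

/-- `π` (an automorphic representation of `GL₂(𝔸_L)`) **is holomorphic of weight `(k, w)`**,
`k = (k_β)_{β : L →+* ℂ}`, `w ∈ ℤ`: it has the infinity type `hilbertInfinityType k w` of the
discrete series `D_{k_β,w}` at every `β` (Buzzard–Diamond–Jarvis 2010, §2: "`π_τ ≅ D_{k_τ,w}` for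
each `τ` … we are picking out the ones that correspond to holomorphic Hilbert modular forms";
recorded through the infinity type, see `hilbertInfinityType`).
[cite: BuzzardDiamondJarvis2010, §2 (before Prop. 2.5)] -/
def IsHolomorphicHilbert (π : AutomorphicRepData (AutomorphyDatum.gl 2 L hcpt))
    (k : (L →+* ℂ) → ℕ) (w : ℤ) : Prop :=
  π.HasInfinityType (hilbertInfinityType k w)

/-- Unfolding lemma for `IsHolomorphicHilbert`. [folklore] -/
theorem isHolomorphicHilbert_iff (π : AutomorphicRepData (AutomorphyDatum.gl 2 L hcpt))
    (k : (L →+* ℂ) → ℕ) (w : ℤ) :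
    π.IsHolomorphicHilbert k w ↔ π.HasInfinityType (hilbertInfinityType k w) :=
  Iff.rfl

/-- **A holomorphic Hilbert automorphic representation of regular paritious weight is regular
algebraic** (Clozel 1990, §3; Buzzard–Diamond–Jarvis 2010, §2): `k_β ≥ 2`, `k_β ≡ w mod 2`.
In particular the tree's `exists_galoisRep_of_regularAlgebraic` (Carayol, Taylor,
Blasius–Rogawski; HLTT) attaches Galois representations to it. [folklore] -/
theorem IsHolomorphicHilbert.isRegularAlgebraic {π : AutomorphicRepData (AutomorphyDatum.gl 2 L hcpt)}
    {k : (L →+* ℂ) → ℕ} {w : ℤ} (h : π.IsHolomorphicHilbert k w)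
    (hpar : ∀ β : L →+* ℂ, (2 : ℤ) ∣ (k β : ℤ) - w) (hk : ∀ β : L →+* ℂ, 2 ≤ k β) :
    π.IsRegularAlgebraic :=
  ⟨_, h, hilbertInfinityType_isRegularAlgebraic hpar hk⟩

end AutomorphicRepData

/-! ### The Frobenius permutation of the embeddings, transported along `ι : ℚ̄_p ≃ ℂ` -/

section Frobenius

variable {L : Type*} [Field L]

/-- **`γ` is the Frobenius twist of `β`** (`β, γ : L →+* ℂ`, read `p`-adically through
`ι : ℚ̄_p ≃+* ℂ`): on algebraic integers `x` of `L` (whose images have `‖ι⁻¹(β x)‖ ≤ 1`),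
`ι⁻¹(γ x) ≡ ι⁻¹(β x)^p` modulo the maximal ideal of `ℤ̄_p`, i.e. the residual embeddings
`β̄, γ̄ : 𝓞 L → ℤ̄_p/𝔪` satisfy `γ̄ = Frob ∘ β̄` ("`γ = σ ∘ β`" in the notation of
Emerton–Reduzzi–Xiao, `σ` the arithmetic Frobenius).  When `p` is unramified in `L` this is the
graph of a permutation of the embeddings. [cite: EmertonReduzziXiao2017, §3.1 (partial Hasse invariants, the Frobenius σ on Σ)] -/
def IsFrobeniusTwist (p : ℕ) [Fact p.Prime] (ι : PadicAlgCl p ≃+* ℂ) (β γ : L →+* ℂ) : Prop :=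
  ∀ x : L, IsIntegral ℤ x → ‖ι.symm (γ x) - ι.symm (β x) ^ p‖ < 1

/-- Unfolding lemma for `IsFrobeniusTwist`. [folklore] -/
theorem isFrobeniusTwist_iff (p : ℕ) [Fact p.Prime] (ι : PadicAlgCl p ≃+* ℂ) (β γ : L →+* ℂ) :
    IsFrobeniusTwist p ι β γ ↔
      ∀ x : L, IsIntegral ℤ x → ‖ι.symm (γ x) - ι.symm (β x) ^ p‖ < 1 :=
  Iff.rfl

end Frobenius

/-! ### The named fact -/

section Statement

/-- **Weight shifting modulo `p` for Hilbert cuspidal eigenforms by partial Hasse invariants and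
Deligne–Serre lifting** (Goren 2001; Andreatta–Goren 2005, §7–8; Emerton–Reduzzi–Xiao 2017,
§3.1 (Lemma 3.1.2, Cor. 3.1.3), §4.2 (Lemma 4.2.2, the cone lemma), §4.3 (proof of Lemma 4.3.2);
Reduzzi–Xiao 2017, Thm. 1.1 and §4.2; Deligne–Serre 1974, Lemme 6.11, proved in the tree as
`DeligneSerre1974.lemma611_holds` — see the module docstring for the chain; ERX numbering as in
arXiv:1307.8003).  The statement is the degree-`0` output of this method — it is invoked in
this form in ERX (Introduction: "the congruences produced via multiplication by the partial
Hasse invariants of [Gor1] and [AG] allow one to attach Galois representations to mod `ϖ_E`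
Hilbert modular eigenforms of any paritious weight") and, for parallel shifts, in
Buzzard–Diamond–Jarvis 2010, proof of Cor. 2.6 — rather than a numbered theorem of one source;
every ingredient is cited at its locator.  Let `L` be a totally real number field of
degree `> 1`, `p` a prime unramified in `L` (`p ∤ disc L`), `ι : ℚ̄_p ≃+* ℂ`, and
`Fr : (L →+* ℂ) → (L →+* ℂ)` the Frobenius permutation of the embeddings read through `ι`
(`IsFrobeniusTwist p ι β (Fr β)` for all `β`; it exists uniquely since `p` is unramified).  Let `π`
be a cuspidal automorphic representation of `GL₂(𝔸_L)`, holomorphic of paritious weight `(k, w)`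
with `k_β ≥ 2` (`IsHolomorphicHilbert`), unramified at every place above `p` (level prime to
`p`).  Then for every `M : (L →+* ℂ) → ℕ` with all `M_β` even there is `n₀` such that for every
`n ≥ n₀` there is a cuspidal automorphic representation `π'` of `GL₂(𝔸_L)`, holomorphic of weight
`(k', w)` with `k'_β = k_β + p·M_{Fr β} - M_β + 2n(p-1)` — the weight of (a mod `p` eigenform of
`π`) `× ∏_τ h_τ^{M_τ + 2n}`, `h_τ` the partial Hasse invariant of weight `p e_{Fr⁻¹∘τ} - e_τ` —
unramified at every place above `p`, and congruent to `π` modulo the maximal ideal of `ℤ̄_p`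
at almost all finite places: for all but finitely many `v`, `π` and `π'` are unramified at `v`
with Satake parameters `α, α'` whose Frobenius polynomials `arithFrobPolyOfSatake ι q_v 2 α`,
`arithFrobPolyOfSatake ι q_v 2 α'` (`ReciprocityGLn`) are coefficientwise congruent
(`‖·‖ < 1` in `ℚ̄_p`).  Named fact (D-0014); `∀ hcpt` threading as in `ReciprocityGLn`.
[cite: EmertonReduzziXiao2017, §3.1 Lemma 3.1.2–Cor. 3.1.3, §4.2 Lemma 4.2.2, §4.3 Lemma 4.3.2 (proof)]
[cite: ReduzziXiao2017, Thm. 1.1 and §4.2] [cite: AndreattaGoren2005, §7–8]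
[cite: Goren2001, construction of the partial Hasse invariants (p unramified)] [cite: DeligneSerreASENS1974, Lemme 6.11] -/
def HilbertPartialHasseWeightShifting : Prop :=
  ∀ (L : Type) [Field L] [NumberField L] [IsTotallyReal L], 1 < Module.finrank ℚ L →
    ∀ (p : ℕ) [Fact p.Prime], ¬ (p : ℤ) ∣ NumberField.discr L →
    ∀ (ι : PadicAlgCl p ≃+* ℂ) (Fr : (L →+* ℂ) → (L →+* ℂ)),
      (∀ β : L →+* ℂ, IsFrobeniusTwist p ι β (Fr β)) →
    ∀ (hcpt : isCompact_glFiniteIntegralLevel 2 L) (π : CuspidalAutomorphicRepData 2 L hcpt)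
      (k : (L →+* ℂ) → ℕ) (w : ℤ),
      (∀ β : L →+* ℂ, 2 ≤ k β) → (∀ β : L →+* ℂ, (2 : ℤ) ∣ (k β : ℤ) - w) →
      π.1.IsHolomorphicHilbert k w →
      (∀ v : HeightOneSpectrum (𝓞 L), ((p : ℕ) : 𝓞 L) ∈ v.asIdeal → π.1.IsUnramifiedAt v) →
    ∀ (M : (L →+* ℂ) → ℕ), (∀ β : L →+* ℂ, Even (M β)) →
      ∃ n₀ : ℕ, ∀ n : ℕ, n₀ ≤ n →
        ∃ (k' : (L →+* ℂ) → ℕ) (π' : CuspidalAutomorphicRepData 2 L hcpt),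
          (∀ β : L →+* ℂ,
              (k' β : ℤ) = k β + p * M (Fr β) - M β + 2 * (n : ℤ) * ((p : ℤ) - 1)) ∧
          π'.1.IsHolomorphicHilbert k' w ∧
          (∀ v : HeightOneSpectrum (𝓞 L), ((p : ℕ) : 𝓞 L) ∈ v.asIdeal →
              π'.1.IsUnramifiedAt v) ∧
          ∀ᶠ v : HeightOneSpectrum (𝓞 L) in Filter.cofinite, ∃ α α' : Multiset ℂ,
            π.1.HasSatakeParamAt v α ∧ π'.1.HasSatakeParamAt v α' ∧
              ∀ i : ℕ, ‖(arithFrobPolyOfSatake ι v.residueCard 2 α).coeff i -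
                  (arithFrobPolyOfSatake ι v.residueCard 2 α').coeff i‖ < 1

end Statement

end Literature.NumberTheory.Automorphic
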